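import Literature.MathematicalPhysics.QuantumFieldTheory.Balaban1983to89.B12Eq213CouplingDependence

/-!
# `Balaban1983to89.B12Eq213HistoryTowerSharp` — T. Bałaban, *Renormalization group approach to lattice gauge field theories. I*,
Commun. Math. Phys. **109** (1987) 249–301 [Balaban1987RG1], (2.1) p. 265, (2.11)–(2.13) pp. 267–268, (0.23) p. 256, p. 298: **the
carried old action CANCELS against the subtraction in the curly bracket of (2.12) — the new action reads the old one ONLY at the
fluctuated field — hence the body's a-priori history moduli are UNIFORM in the age (constant, neither growing nor fading):
`|𝐄_k(g′; U) − 𝐄_k(g; U)| ≤ (L_P + L_τ + L_R)·Σ_{i<k}|g′_i − g_i|`, kernel-checked on the body of record**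

statement-level skeleton of published theorems with citation tags; proofs where landed; nothing here is a claim about
the Yang–Mills mass gap

PDF held: `paper:balaban1987-cmp109-rg-i-small-field` (journal page = PDF page + 248); pp. 256, 265, 267–268 re-read this session.

CITATION HEADER / WHAT IS REPRODUCED (cell `pub-ymgap`, HUMAN RULING D-0062 Track A, seat `pub-ymgap-dag-n22-b` = the
FIRST-MISSING-ESTIMATE seat of DAG node N22 = NE9; ninth module of the body-level chain, SHARPENING `B12Eq213HistoryTower` (p409692 ∕
v1.1 p411007: moduli `(L + L_R)·3^{k−1−i}` by two triangle inequalities); a NEW LEAF over `B12Eq213CouplingDependence` (p409146 ∕ v1.1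
p409833), nothing there modified).

THE PRINT.  p. 268 [PDF 20] (2.12): the new action is `−(1/g_k²)A(U_{k+1}) + 𝐄_k(U_{k+1}) + [log Z^{(k)}(U_{k+1}) − log Z^{(k)}(1)] +
log 𝐍″_k⁻¹∫dμ_{C^{(k)}}(B) χ_k exp[𝐏^{(k)}(g_k, U_{k+1}, B) + {𝐄_k(U_k(exp i[g_kCB − hD̃(g_kCB)]V^{(k)})) − 𝐄_k(U_k(V^{(k)}))}]` — the old
action `𝐄_k` appears ONCE outside the integral (read at the new field) and is SUBTRACTED once inside the curly bracket at the same
configuration; the subtraction is the bookkeeping that exhibits the fluctuation part as small (p. 268: *«another is the expression in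
the curly bracket {…}»*), and it came from (2.1) p. 265 ∕ (2.11) p. 267 where the integrand carries the full `𝐄_k(U_k(exp iB′V^{(k)}))`.
Since `𝐄_k(U_k(V^{(k)}))` does not depend on the fluctuation variable, `log ∫ χ_k e^{𝐏 + 𝐄_k∘τ − 𝐄_k(σU)} = log ∫ χ_k e^{𝐏 + 𝐄_k∘τ} − 𝐄_k(σU)`:
THE TWO OCCURRENCES CANCEL, and `𝐄_{k+1}(U) = log ∫ χ_k e^{𝐏^{(k)}(g_k,U,B) + 𝐄_k(τ(g_k,U,B))} dμ_U(B) + (history-free)` — in the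
recursion model of `B12Eq213HistoryTower`, where the carried action and the bracket's subtraction are read at the SAME configuration
`σ_k(U)` (print's `U_{k+1}` of the first line of (2.12) and `U_k(V^{(k)})` of the bracket denote the same background field: (2.12) is
(2.11) with `𝐄_k(U_k(V^{(k)}))` added and subtracted).  p. 256 (0.23), p. 298: the history dependence in words; NOTHING quantitative printed.

WHAT THIS MODULE DOES (THEOREMS ONLY; no definition, no named fact):
* §1 **`newTerm_bracket_add_carried`** — on the body, for any old action `E_k`, bracket maps `τ, σ` and a positive un-subtracted integral:
  `newTerm {D with Q := 𝐄_k∘τ − 𝐄_k(σ·)} g_k U + 𝐄_k(σ U) = newTerm {D with Q := 𝐄_k∘τ} g_k U` (translation equivariance of `log ∫χe^{F}`).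
* §2 **`abs_step_le_sharp`** ∕ **`abs_action_sub_action_le_tower_unsubtracted`** — the (0.23)+(2.13) recursion in the UN-SUBTRACTED form
  `E (k+1) h U = newTerm {D k with Q := E k h ∘ τ k} (h k) U + R k (h k) U` under two histories `g, g′` in a window `W`: with ONE
  `g_k`-Lipschitz constant `L_P` of `𝐏^{(k)}` and ONE `L_τ` of the old action ALONG THE BRACKET'S COUPLING CURVE `a ↦ 𝐄_k(τ(a,U,B))` on the
  small-field support (displayed — for Bałaban: (1.17) ∘ the substitution, module `B12Eq212BracketCoupling`), `L_R` for the remainder,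
  domain compatibility `τ k a (Dom (k+1)) ⊆ Dom k` on the support, integrability and positivity: for every `k` and `U ∈ Dom k`,
  `|E k g′ U − E k g U| ≤ (L_P + L_τ + L_R)·Σ_{i<k} |g′ i − g i|` — CONSTANT history moduli (the `T4OutputRate.historySum_const` regime:
  uniform in the age, not summable in the history length), by ONE application per step of `B12Eq213CouplingDependence.abs_newTerm_sub_newTerm_le_joint`.
* §3 `abs_action_sub_action_le_tower_sharp` — the same conclusion for the SUBTRACTED recursion of `B12Eq213HistoryTower` (`hrec` with the
  carried `E k h (σ k U)`), via §1.
HONEST READING: this corrects the READING (not the validity) of `B12Eq213HistoryTower`'s `3^{age}`: the factor 3 is an artefact of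
bounding the carried action and the bracket separately; the body's true a-priori regime is MARGINAL — history moduli O(1) uniformly in
the age, neither exploding nor fading.  `T4OutputRate.FadingMemory` (DECAY in the age) remains exactly the content of the localized
one-step analysis W1 ([II] §§1–2); nothing here touches it.

v1.1 (APPEND-ONLY, same seat; §§1–3 byte-identical): §4 `abs_step_le_sharp_of_lip` ∕ `abs_action_sub_action_le_tower_sharp_of_lip` — the
sharp tower fed by a NEW-TERM-LEVEL Lipschitz modulus `Λ` (e.g. `B12Eq213GaussianLastCoupling.abs_newTerm_sub_newTerm_gaussian_of_quadDom`)
instead of the exponent-level `L_P + L_τ`: constant moduli `(Λ + L_R)`.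

HONEST FRAMING: count-neutral Track-A side module; NOT a discharge of node N22; one finite T⁴ programme at fixed ε, Bałaban AS PRINTED with
locators; nothing continuum ∕ ℝ⁴ ∕ OS ∕ mass-gap ∕ Clay.
-/

noncomputable section

namespace Literature.MathematicalPhysics.QuantumFieldTheory.Balaban1983to89.B12Eq213HistoryTowerSharp

open _root_.MeasureTheory
open scoped BigOperators
open Literature.MathematicalPhysics.QuantumFieldTheory.Balaban1983to89
open Literature.MathematicalPhysics.QuantumFieldTheory.Balaban1983to89.B12Eq213Body268 (FluctData)
open Literature.MathematicalPhysics.QuantumFieldTheory.Balaban1983to89.B12Eq213CouplingDependence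

variable {Y : Type*}

/-! ## §1. The carried old action cancels against the bracket's subtraction -/

/-- **THE CANCELLATION**: for the body `D`, an old action `E_k : Y → ℝ`, the bracket's configuration maps `τ` (fluctuated field) and `σ`
(new field), if the un-subtracted integral `∫ χ_U e^{𝐏(g_k,U,B) + 𝐄_k(τ(g_k,U,B))} dμ_U` is positive, then
`newTerm {D with Q := 𝐄_k∘τ − 𝐄_k(σ·)} g_k U + 𝐄_k(σ U) = newTerm {D with Q := 𝐄_k∘τ} g_k U` — the `𝐄_k(U_{k+1})` of the first line of
(2.12) and the `−𝐄_k(U_k(V^{(k)}))` of its curly bracket cancel (translation equivariance of `log ∫ χ e^{F}`; the un-subtracted form is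
(2.1) ∕ (2.11)). [cite: Balaban1987RG1, (2.11)–(2.13) pp.267–268 and (2.1) p.265] -/
theorem newTerm_bracket_add_carried (D : FluctData Y) (τ : ℝ → Y → D.𝓑 → Y) (σ : Y → Y) (Ek : Y → ℝ) (gk : ℝ) (U : Y)
    (hpos : 0 < FluctData.integral { D with Q := fun a U B => Ek (τ a U B) } gk U) :
    FluctData.newTerm { D with Q := fun a U B => Ek (τ a U B) - Ek (σ U) } gk U + Ek (σ U)
      = FluctData.newTerm { D with Q := fun a U B => Ek (τ a U B) } gk U := by
  have hI : FluctData.integral { D with Q := fun a U B => Ek (τ a U B) - Ek (σ U) } gk U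
      = Real.exp (-Ek (σ U)) * FluctData.integral { D with Q := fun a U B => Ek (τ a U B) } gk U := by
    rw [FluctData.integral, FluctData.integral, ← integral_const_mul]
    refine integral_congr_ae (Filter.Eventually.of_forall fun B => ?_)
    show D.χ U B * Real.exp (D.P gk U B + (Ek (τ gk U B) - Ek (σ U)))
      = Real.exp (-Ek (σ U)) * (D.χ U B * Real.exp (D.P gk U B + Ek (τ gk U B)))
    have e : D.P gk U B + (Ek (τ gk U B) - Ek (σ U)) = (D.P gk U B + Ek (τ gk U B)) + (-Ek (σ U)) := by ring
    rw [e, Real.exp_add]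
    ring
  rw [FluctData.newTerm, FluctData.newTerm, hI, Real.log_mul (Real.exp_pos _).ne' hpos.ne', Real.log_exp]
  ring

/-! ## §2. The tower in the un-subtracted form: CONSTANT history moduli -/

/-- **ONE STEP, SHARP**: two histories' old actions `s`-close on `Dom k`; the un-subtracted new terms at the new field `U` (for the
same step datum, brackets `𝐄_k∘τ`, `𝐄′_k∘τ`, last couplings `g_k`, `g′_k` in the window): if `𝐏^{(k)}` is `L_P`-Lipschitz and the second
history's old action is `L_τ`-Lipschitz ALONG THE COUPLING CURVE `a ↦ 𝐄′_k(τ(a,U,B))` between the two couplings on the support of `χ_U`,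
`τ(g_k,U,B) ∈ Dom k` there, integrability ∕ positivity, and `R` is `L_R`-Lipschitz, then the new total actions are
`s + (L_P + L_τ + L_R)·|g′_k − g_k|`-close at `U` — factor ONE on `s`. [cite: Balaban1987RG1, (2.11)–(2.13) pp.267–268 and §0 (0.23) p.256] -/
theorem abs_step_le_sharp (D : FluctData Y) (τ : ℝ → Y → D.𝓑 → Y) (R : ℝ → Y → ℝ) (Ek Ek' : Y → ℝ)
    (S : Set Y) {s LP Lτ LR gk gk' : ℝ} {U : Y} (hS : ∀ y ∈ S, |Ek' y - Ek y| ≤ s)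
    (hτ : ∀ B, D.χ U B ≠ 0 → τ gk U B ∈ S)
    (hint : Integrable (FluctData.integrand { D with Q := fun a U B => Ek (τ a U B) } gk U) (D.μ U))
    (hint'g : Integrable (FluctData.integrand { D with Q := fun a U B => Ek' (τ a U B) } gk U) (D.μ U))
    (hint'g' : Integrable (FluctData.integrand { D with Q := fun a U B => Ek' (τ a U B) } gk' U) (D.μ U))
    (hpos : 0 < FluctData.integral { D with Q := fun a U B => Ek (τ a U B) } gk U)
    (hpos' : 0 < FluctData.integral { D with Q := fun a U B => Ek' (τ a U B) } gk U)
    (hP : ∀ B, D.χ U B ≠ 0 → |D.P gk' U B - D.P gk U B| ≤ LP * |gk' - gk|)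
    (hEτ : ∀ B, D.χ U B ≠ 0 → |Ek' (τ gk' U B) - Ek' (τ gk U B)| ≤ Lτ * |gk' - gk|)
    (hR : |R gk' U - R gk U| ≤ LR * |gk' - gk|) :
    |(FluctData.newTerm { D with Q := fun a U B => Ek' (τ a U B) } gk' U + R gk' U) -
      (FluctData.newTerm { D with Q := fun a U B => Ek (τ a U B) } gk U + R gk U)|
      ≤ s + (LP + Lτ + LR) * |gk' - gk| := by
  -- the second history's exponent is (L_P + L_τ)-Lipschitz in the last coupling on the support
  have hL : ∀ B, D.χ U B ≠ 0 →
      |FluctData.exponent { D with Q := fun a U B => Ek' (τ a U B) } gk' U B -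
        FluctData.exponent { D with Q := fun a U B => Ek' (τ a U B) } gk U B| ≤ (LP + Lτ) * |gk' - gk| := by
    intro B hB
    show |(D.P gk' U B + Ek' (τ gk' U B)) - (D.P gk U B + Ek' (τ gk U B))| ≤ (LP + Lτ) * |gk' - gk|
    have e : (D.P gk' U B + Ek' (τ gk' U B)) - (D.P gk U B + Ek' (τ gk U B))
        = (D.P gk' U B - D.P gk U B) + (Ek' (τ gk' U B) - Ek' (τ gk U B)) := by ring
    rw [e]
    calc |(D.P gk' U B - D.P gk U B) + (Ek' (τ gk' U B) - Ek' (τ gk U B))|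
        ≤ |D.P gk' U B - D.P gk U B| + |Ek' (τ gk' U B) - Ek' (τ gk U B)| := abs_add_le _ _
      _ ≤ LP * |gk' - gk| + Lτ * |gk' - gk| := add_le_add (hP B hB) (hEτ B hB)
      _ = (LP + Lτ) * |gk' - gk| := by ring
  -- the two brackets differ by ≤ s at the common coupling g_k
  have hr : ∀ B, D.χ U B ≠ 0 →
      |(fun a U B => Ek' (τ a U B)) gk U B - (fun a U B => Ek (τ a U B)) gk U B| ≤ s :=
    fun B hB => hS _ (hτ B hB)
  have hN := abs_newTerm_sub_newTerm_le_joint { D with Q := fun a U B => Ek (τ a U B) }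
    (fun a U B => Ek' (τ a U B)) hint hint'g hint'g' hpos hpos' hL hr
  have e : (FluctData.newTerm { D with Q := fun a U B => Ek' (τ a U B) } gk' U + R gk' U) -
      (FluctData.newTerm { D with Q := fun a U B => Ek (τ a U B) } gk U + R gk U)
      = (FluctData.newTerm { D with Q := fun a U B => Ek' (τ a U B) } gk' U -
          FluctData.newTerm { D with Q := fun a U B => Ek (τ a U B) } gk U) + (R gk' U - R gk U) := by ring
  rw [e]
  calc |(FluctData.newTerm { D with Q := fun a U B => Ek' (τ a U B) } gk' U -
          FluctData.newTerm { D with Q := fun a U B => Ek (τ a U B) } gk U) + (R gk' U - R gk U)|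
      ≤ |FluctData.newTerm { D with Q := fun a U B => Ek' (τ a U B) } gk' U -
          FluctData.newTerm { D with Q := fun a U B => Ek (τ a U B) } gk U| + |R gk' U - R gk U| := abs_add_le _ _
    _ ≤ ((LP + Lτ) * |gk' - gk| + s) + LR * |gk' - gk| := add_le_add hN hR
    _ = s + (LP + Lτ + LR) * |gk' - gk| := by ring

/-- **THE TOWER IN THE UN-SUBTRACTED FORM — CONSTANT HISTORY MODULI.**  Per step `k`: the step datum `D k`, the bracket's coupling
curve `τ k`, the history-free remainder `R k`, small-field domains `Dom k`; the total old action `E k h` of a history `h` with no history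
at step 0 (`hE0`) and the recursion in the form (2.1)∕(2.11): `E (k+1) h U = newTerm {D k with Q := 𝐄_k^h ∘ τ k} (h k) U + R k (h k) U`.
With, at every step and for the two histories `g, g′` (couplings in `W`): integrability ∕ positivity, the domain compatibility of `τ`,
ONE `L_P` for `𝐏^{(k)}`, ONE `L_τ` for the old actions along the coupling curve, `L_R` for `R` — for every `k` and `U ∈ Dom k`:
`|E k g′ U − E k g U| ≤ (L_P + L_τ + L_R) · Σ_{i<k} |g′ i − g i|` — joint Lipschitz in the whole history with moduli UNIFORM in the
age (the marginal regime; compare `B12Eq213HistoryTower.abs_action_sub_action_le_tower`'s `3^{age}`). [cite: Balaban1987RG1, §0 (0.23) p.256, (2.11)–(2.13) pp.267–268 and §5 p.298] -/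
theorem abs_action_sub_action_le_tower_unsubtracted (D : ℕ → FluctData Y) (τ : (k : ℕ) → ℝ → Y → (D k).𝓑 → Y)
    (R : ℕ → ℝ → Y → ℝ) (E : ℕ → (ℕ → ℝ) → Y → ℝ) (Dom : ℕ → Set Y) (W : Set ℝ) {LP Lτ LR : ℝ}
    (g g' : ℕ → ℝ) (hg : ∀ k, g k ∈ W) (hg' : ∀ k, g' k ∈ W)
    (hE0 : ∀ U, E 0 g' U = E 0 g U)
    (hrec : ∀ (h : ℕ → ℝ) (k : ℕ) (U : Y), (∀ i, h i ∈ W) →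
      E (k + 1) h U = FluctData.newTerm { D k with Q := fun a U B => E k h (τ k a U B) } (h k) U + R k (h k) U)
    (hτ : ∀ k U, U ∈ Dom (k + 1) → ∀ a ∈ W, ∀ B, (D k).χ U B ≠ 0 → τ k a U B ∈ Dom k)
    (hint : ∀ (h : ℕ → ℝ) (k : ℕ), (∀ i, h i ∈ W) → ∀ U ∈ Dom (k + 1), ∀ a ∈ W,
      Integrable (FluctData.integrand { D k with Q := fun a U B => E k h (τ k a U B) } a U) ((D k).μ U))
    (hpos : ∀ (h : ℕ → ℝ) (k : ℕ), (∀ i, h i ∈ W) → ∀ U ∈ Dom (k + 1), ∀ a ∈ W,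
      0 < FluctData.integral { D k with Q := fun a U B => E k h (τ k a U B) } a U)
    (hP : ∀ k, ∀ U ∈ Dom (k + 1), ∀ B, (D k).χ U B ≠ 0 → ∀ a ∈ W, ∀ a' ∈ W,
      |(D k).P a' U B - (D k).P a U B| ≤ LP * |a' - a|)
    (hEτ : ∀ (h : ℕ → ℝ) (k : ℕ), (∀ i, h i ∈ W) → ∀ U ∈ Dom (k + 1), ∀ B, (D k).χ U B ≠ 0 → ∀ a ∈ W, ∀ a' ∈ W,
      |E k h (τ k a' U B) - E k h (τ k a U B)| ≤ Lτ * |a' - a|)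
    (hR : ∀ k, ∀ U ∈ Dom (k + 1), ∀ a ∈ W, ∀ a' ∈ W, |R k a' U - R k a U| ≤ LR * |a' - a|) :
    ∀ k, ∀ U ∈ Dom k, |E k g' U - E k g U| ≤ (LP + Lτ + LR) * ∑ i ∈ Finset.range k, |g' i - g i| := by
  intro k
  induction k with
  | zero => intro U _; simp [hE0 U]
  | succ k ih =>
    intro U hU
    rw [hrec g' k U hg', hrec g k U hg, Finset.sum_range_succ, mul_add]
    have hstep := abs_step_le_sharp (D k) (τ k) (R k) (E k g) (E k g') (Dom k)
      (s := (LP + Lτ + LR) * ∑ i ∈ Finset.range k, |g' i - g i|) ih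
      (fun B hB => hτ k U hU (g k) (hg k) B hB)
      (hint g k hg U hU (g k) (hg k)) (hint g' k hg' U hU (g k) (hg k)) (hint g' k hg' U hU (g' k) (hg' k))
      (hpos g k hg U hU (g k) (hg k)) (hpos g' k hg' U hU (g k) (hg k))
      (fun B hB => hP k U hU B hB (g k) (hg k) (g' k) (hg' k))
      (fun B hB => hEτ g' k hg' U hU B hB (g k) (hg k) (g' k) (hg' k))
      (hR k U hU (g k) (hg k) (g' k) (hg' k))
    exact hstep

/-! ## §3. The same for the subtracted recursion of (2.12) -/

/-- **THE SHARP TOWER FOR THE SUBTRACTED RECURSION** (the `hrec` of `B12Eq213HistoryTower`, with the carried `E k h (σ k U)` and the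
subtracting bracket): under positivity of the un-subtracted integrals the two recursions agree (`newTerm_bracket_add_carried`), so the
same CONSTANT moduli hold: `|E k g′ U − E k g U| ≤ (L_P + L_τ + L_R)·Σ_{i<k}|g′ i − g i|` on `Dom k`.
[cite: Balaban1987RG1, §0 (0.23) p.256, (2.12)–(2.13) p.268 and §5 p.298] -/
theorem abs_action_sub_action_le_tower_sharp (D : ℕ → FluctData Y) (τ : (k : ℕ) → ℝ → Y → (D k).𝓑 → Y) (σ : ℕ → Y → Y)
    (R : ℕ → ℝ → Y → ℝ) (E : ℕ → (ℕ → ℝ) → Y → ℝ) (Dom : ℕ → Set Y) (W : Set ℝ) {LP Lτ LR : ℝ}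
    (g g' : ℕ → ℝ) (hg : ∀ k, g k ∈ W) (hg' : ∀ k, g' k ∈ W)
    (hE0 : ∀ U, E 0 g' U = E 0 g U)
    (hrec : ∀ (h : ℕ → ℝ) (k : ℕ) (U : Y), (∀ i, h i ∈ W) →
      E (k + 1) h U = E k h (σ k U) +
        FluctData.newTerm { D k with Q := fun a U B => E k h (τ k a U B) - E k h (σ k U) } (h k) U + R k (h k) U)
    (hτ : ∀ k U, U ∈ Dom (k + 1) → ∀ a ∈ W, ∀ B, (D k).χ U B ≠ 0 → τ k a U B ∈ Dom k)
    (hint : ∀ (h : ℕ → ℝ) (k : ℕ), (∀ i, h i ∈ W) → ∀ U ∈ Dom (k + 1), ∀ a ∈ W,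
      Integrable (FluctData.integrand { D k with Q := fun a U B => E k h (τ k a U B) } a U) ((D k).μ U))
    (hpos : ∀ (h : ℕ → ℝ) (k : ℕ), (∀ i, h i ∈ W) → ∀ U ∈ Dom (k + 1), ∀ a ∈ W,
      0 < FluctData.integral { D k with Q := fun a U B => E k h (τ k a U B) } a U)
    (hP : ∀ k, ∀ U ∈ Dom (k + 1), ∀ B, (D k).χ U B ≠ 0 → ∀ a ∈ W, ∀ a' ∈ W,
      |(D k).P a' U B - (D k).P a U B| ≤ LP * |a' - a|)
    (hEτ : ∀ (h : ℕ → ℝ) (k : ℕ), (∀ i, h i ∈ W) → ∀ U ∈ Dom (k + 1), ∀ B, (D k).χ U B ≠ 0 → ∀ a ∈ W, ∀ a' ∈ W,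
      |E k h (τ k a' U B) - E k h (τ k a U B)| ≤ Lτ * |a' - a|)
    (hR : ∀ k, ∀ U ∈ Dom (k + 1), ∀ a ∈ W, ∀ a' ∈ W, |R k a' U - R k a U| ≤ LR * |a' - a|) :
    ∀ k, ∀ U ∈ Dom k, |E k g' U - E k g U| ≤ (LP + Lτ + LR) * ∑ i ∈ Finset.range k, |g' i - g i| := by
  -- the subtracted recursion IS the un-subtracted one at the new fields of the domains (the carried term cancels)
  have hrec' : ∀ (h : ℕ → ℝ) (k : ℕ) (U : Y), (∀ i, h i ∈ W) → U ∈ Dom (k + 1) →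
      E (k + 1) h U = FluctData.newTerm { D k with Q := fun a U B => E k h (τ k a U B) } (h k) U + R k (h k) U := by
    intro h k U hh hU
    rw [hrec h k U hh, ← newTerm_bracket_add_carried (D k) (τ k) (σ k) (E k h) (h k) U (hpos h k hh U hU (h k) (hh k))]
    ring
  intro k
  induction k with
  | zero => intro U _; simp [hE0 U]
  | succ k ih =>
    intro U hU
    rw [hrec' g' k U hg' hU, hrec' g k U hg hU, Finset.sum_range_succ, mul_add]
    exact abs_step_le_sharp (D k) (τ k) (R k) (E k g) (E k g') (Dom k)
      (s := (LP + Lτ + LR) * ∑ i ∈ Finset.range k, |g' i - g i|) ih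
      (fun B hB => hτ k U hU (g k) (hg k) B hB)
      (hint g k hg U hU (g k) (hg k)) (hint g' k hg' U hU (g k) (hg k)) (hint g' k hg' U hU (g' k) (hg' k))
      (hpos g k hg U hU (g k) (hg k)) (hpos g' k hg' U hU (g k) (hg k))
      (fun B hB => hP k U hU B hB (g k) (hg k) (g' k) (hg' k))
      (fun B hB => hEτ g' k hg' U hU B hB (g k) (hg k) (g' k) (hg' k))
      (hR k U hU (g k) (hg k) (g' k) (hg' k))

/-! ## §4 (v1.1). The sharp tower from a NEW-TERM-LEVEL Lipschitz input

As `B12Eq213HistoryTower` §2 did for the unsharp tower: the last-coupling step is fed by a Lipschitz modulus `Λ` of the un-subtracted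
new term `a ↦ newTerm {D with Q := 𝐄′_k∘τ} a U` itself (e.g. the effective Gaussian modulus of `B12Eq213GaussianLastCoupling` §4), instead
of an exponent-level `L_P + L_τ`; the bracket comparison at the common coupling stays exponent-level (`s`-close old actions). -/

/-- **ONE STEP, SHARP, FROM A NEW-TERM-LEVEL MODULUS**: old actions `s`-close on `Dom k ⊇ τ(g_k,U,supp χ_U)`; the second history's
un-subtracted new term `Λ`-Lipschitz between the two couplings (`hN`); `R` `L_R`-Lipschitz; integrability ∕ positivity at the common
coupling: the new total actions are `s + (Λ + L_R)|g′_k − g_k|`-close at `U`. [cite: Balaban1987RG1, (2.11)–(2.13) pp.267–268 and §0 (0.23) p.256] -/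
theorem abs_step_le_sharp_of_lip (D : FluctData Y) (τ : ℝ → Y → D.𝓑 → Y) (R : ℝ → Y → ℝ) (Ek Ek' : Y → ℝ)
    (S : Set Y) {s Λ LR gk gk' : ℝ} {U : Y} (hS : ∀ y ∈ S, |Ek' y - Ek y| ≤ s)
    (hτ : ∀ B, D.χ U B ≠ 0 → τ gk U B ∈ S)
    (hint : Integrable (FluctData.integrand { D with Q := fun a U B => Ek (τ a U B) } gk U) (D.μ U))
    (hint'g : Integrable (FluctData.integrand { D with Q := fun a U B => Ek' (τ a U B) } gk U) (D.μ U))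
    (hpos : 0 < FluctData.integral { D with Q := fun a U B => Ek (τ a U B) } gk U)
    (hN : |FluctData.newTerm { D with Q := fun a U B => Ek' (τ a U B) } gk' U -
        FluctData.newTerm { D with Q := fun a U B => Ek' (τ a U B) } gk U| ≤ Λ * |gk' - gk|)
    (hR : |R gk' U - R gk U| ≤ LR * |gk' - gk|) :
    |(FluctData.newTerm { D with Q := fun a U B => Ek' (τ a U B) } gk' U + R gk' U) -
      (FluctData.newTerm { D with Q := fun a U B => Ek (τ a U B) } gk U + R gk U)|
      ≤ s + (Λ + LR) * |gk' - gk| := by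
  -- the two brackets at the common coupling g_k: s-close exponents ⇒ s-close new terms
  have hQ := abs_newTerm_withQ_sub_newTerm_le { D with Q := fun a U B => Ek (τ a U B) } (fun a U B => Ek' (τ a U B))
    (g := gk) (U := U) (r := s) hint hint'g hpos (fun B hB => hS _ (hτ B hB))
  have e : (FluctData.newTerm { D with Q := fun a U B => Ek' (τ a U B) } gk' U + R gk' U) -
      (FluctData.newTerm { D with Q := fun a U B => Ek (τ a U B) } gk U + R gk U)
      = (FluctData.newTerm { D with Q := fun a U B => Ek' (τ a U B) } gk' U -
          FluctData.newTerm { D with Q := fun a U B => Ek' (τ a U B) } gk U)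
        + (FluctData.newTerm { D with Q := fun a U B => Ek' (τ a U B) } gk U -
          FluctData.newTerm { D with Q := fun a U B => Ek (τ a U B) } gk U) + (R gk' U - R gk U) := by ring
  rw [e]
  calc |(FluctData.newTerm { D with Q := fun a U B => Ek' (τ a U B) } gk' U -
          FluctData.newTerm { D with Q := fun a U B => Ek' (τ a U B) } gk U)
        + (FluctData.newTerm { D with Q := fun a U B => Ek' (τ a U B) } gk U -
          FluctData.newTerm { D with Q := fun a U B => Ek (τ a U B) } gk U) + (R gk' U - R gk U)|
      ≤ |FluctData.newTerm { D with Q := fun a U B => Ek' (τ a U B) } gk' U -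
          FluctData.newTerm { D with Q := fun a U B => Ek' (τ a U B) } gk U|
        + |FluctData.newTerm { D with Q := fun a U B => Ek' (τ a U B) } gk U -
          FluctData.newTerm { D with Q := fun a U B => Ek (τ a U B) } gk U| + |R gk' U - R gk U| :=
          (abs_add_le _ _).trans (add_le_add (abs_add_le _ _) le_rfl)
    _ ≤ Λ * |gk' - gk| + s + LR * |gk' - gk| := add_le_add (add_le_add hN hQ) hR
    _ = s + (Λ + LR) * |gk' - gk| := by ring

/-- **THE SHARP TOWER FROM NEW-TERM-LEVEL MODULI** (un-subtracted recursion): with ONE Lipschitz constant `Λ` for the un-subtracted new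
terms `a ↦ newTerm {D k with Q := 𝐄^h_k ∘ τ k} a U` of every history `h` in the window on every `U ∈ Dom (k+1)`, `L_R` for `R`, domain
compatibility of `τ`, integrability ∕ positivity: `|E k g′ U − E k g U| ≤ (Λ + L_R)·Σ_{i<k}|g′ i − g i|` on `Dom k` — CONSTANT moduli, fed
by e.g. `B12Eq213GaussianLastCoupling.abs_newTerm_sub_newTerm_gaussian_of_quadDom`. [cite: Balaban1987RG1, §0 (0.23) p.256, (2.11)–(2.13) pp.267–268 and §5 p.298] -/
theorem abs_action_sub_action_le_tower_sharp_of_lip (D : ℕ → FluctData Y) (τ : (k : ℕ) → ℝ → Y → (D k).𝓑 → Y)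
    (R : ℕ → ℝ → Y → ℝ) (E : ℕ → (ℕ → ℝ) → Y → ℝ) (Dom : ℕ → Set Y) (W : Set ℝ) {Λ LR : ℝ}
    (g g' : ℕ → ℝ) (hg : ∀ k, g k ∈ W) (hg' : ∀ k, g' k ∈ W)
    (hE0 : ∀ U, E 0 g' U = E 0 g U)
    (hrec : ∀ (h : ℕ → ℝ) (k : ℕ) (U : Y), (∀ i, h i ∈ W) →
      E (k + 1) h U = FluctData.newTerm { D k with Q := fun a U B => E k h (τ k a U B) } (h k) U + R k (h k) U)
    (hτ : ∀ k U, U ∈ Dom (k + 1) → ∀ a ∈ W, ∀ B, (D k).χ U B ≠ 0 → τ k a U B ∈ Dom k)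
    (hint : ∀ (h : ℕ → ℝ) (k : ℕ), (∀ i, h i ∈ W) → ∀ U ∈ Dom (k + 1), ∀ a ∈ W,
      Integrable (FluctData.integrand { D k with Q := fun a U B => E k h (τ k a U B) } a U) ((D k).μ U))
    (hpos : ∀ (h : ℕ → ℝ) (k : ℕ), (∀ i, h i ∈ W) → ∀ U ∈ Dom (k + 1), ∀ a ∈ W,
      0 < FluctData.integral { D k with Q := fun a U B => E k h (τ k a U B) } a U)
    (hN : ∀ (h : ℕ → ℝ) (k : ℕ), (∀ i, h i ∈ W) → ∀ U ∈ Dom (k + 1), ∀ a ∈ W, ∀ a' ∈ W,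
      |FluctData.newTerm { D k with Q := fun a U B => E k h (τ k a U B) } a' U -
        FluctData.newTerm { D k with Q := fun a U B => E k h (τ k a U B) } a U| ≤ Λ * |a' - a|)
    (hR : ∀ k, ∀ U ∈ Dom (k + 1), ∀ a ∈ W, ∀ a' ∈ W, |R k a' U - R k a U| ≤ LR * |a' - a|) :
    ∀ k, ∀ U ∈ Dom k, |E k g' U - E k g U| ≤ (Λ + LR) * ∑ i ∈ Finset.range k, |g' i - g i| := by
  intro k
  induction k with
  | zero => intro U _; simp [hE0 U]
  | succ k ih =>
    intro U hU
    rw [hrec g' k U hg', hrec g k U hg, Finset.sum_range_succ, mul_add]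
    exact abs_step_le_sharp_of_lip (D k) (τ k) (R k) (E k g) (E k g') (Dom k)
      (s := (Λ + LR) * ∑ i ∈ Finset.range k, |g' i - g i|) ih
      (fun B hB => hτ k U hU (g k) (hg k) B hB)
      (hint g k hg U hU (g k) (hg k)) (hint g' k hg' U hU (g k) (hg k))
      (hpos g k hg U hU (g k) (hg k))
      (hN g' k hg' U hU (g k) (hg k) (g' k) (hg' k))
      (hR k U hU (g k) (hg k) (g' k) (hg' k))

end Literature.MathematicalPhysics.QuantumFieldTheory.Balaban1983to89.B12Eq213HistoryTowerSharp
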